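import Mathlib.Data.List.Perm.Basic
import Mathlib.Tactic.Linarith
import Mathlib.Tactic.NormNum
import Summits.Ventures.CertifiedManyBodySolver.Downfold.PhaseMapOrdering

/-!
# The T_c ORDERING statistic is a property of the SET of decided members: permutation invariance of the pair
# counts, the ordering score and the truth-maximum clause (ACCEPTANCE §4.6)

Venture CertifiedManyBodySolver, cell `pub/hubbard-downfold`, seat hubbard-downfold-score-1 (second scoring
engine); namespace `Summit.Ventures.CertifiedManyBodySolver.Downfold.CellScore` (continues `PhaseMapOrdering.lean`:
`Member`, `pairClass`, `pairs`, `nClass`, `orderingScore`, `maxMemberDiscordant`, `orderingClause`, `pairClass_symm`).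
Everything here is PROVED.

WHAT THIS IS NOT: not a statement about any material. The two scorers (`deputy-2/score.py`, `validation/score/phasemap.py`)
enumerate the decided members of an ordering group in FILE order and count pairs `i < j`; `PhaseMapOrdering.pairClass_symm`
showed that one pair's class does not depend on which member comes first. This file lifts that to the whole statistic:

* `pairs_perm_count` — for any Boolean pair predicate that is SYMMETRIC on the members at hand, the number of enumerated
  pairs satisfying it is invariant under every permutation of the member list (proof by `List.Perm` induction: the swap
  step trades the pair (a, b) for (b, a), everything else is a permutation of the same pairs).
* `nClass_perm`, `orderingScore_perm`, `maxMemberDiscordant_perm`, `orderingClause_perm` — hence the concordant /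
  discordant / overlapping counts, the §4.6 number of record, the v1.3 truth-maximum count and the §7 clause reading
  do not depend on the enumeration order, for well-formed bands (`lo ≤ hi`) and non-negative tolerances — the
  hypotheses under which `pairClass_symm` holds. So two assemblers listing the same maps in different orders, or a
  re-assembly that reorders files (run-2026-08-26c was assembled three times in twenty minutes), print the same
  ordering numbers.
* §3: the LSCO reversed set of `PhaseMapOrdering` §3 in the opposite file order gives the same 4 / 1 / 1 and 4/5.
-/

namespace Summit.Ventures.CertifiedManyBodySolver.Downfold

namespace CellScore

section perm

variable {l₁ l₂ : List Member}

/-- Well-formedness of a member as `pairClass_symm` needs it: `lo ≤ hi` and `0 ≤ τ` (a Boolean, as a validator would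
print it). [folklore] -/
def Member.wf (m : Member) : Bool := decide (m.lo ≤ m.hi) && decide (0 ≤ m.τ)

/-- `Member.wf` unfolded. [folklore] -/
theorem Member.wf_iff {m : Member} : m.wf = true ↔ m.lo ≤ m.hi ∧ 0 ≤ m.τ := by simp [Member.wf]

/-- Counting over `pairs` is invariant under permutations of the list, for a predicate symmetric on its members.
[folklore] -/
theorem pairs_perm_count (f : Member → Member → Bool) (h : l₁.Perm l₂)
    (hsymm : ∀ a ∈ l₁, ∀ b ∈ l₁, f a b = f b a) :
    (pairs l₁).countP (fun p => f p.1 p.2) = (pairs l₂).countP (fun p => f p.1 p.2) := by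
  induction h with
  | nil => rfl
  | @cons a l₁ l₂ h ih =>
    simp only [pairs, List.countP_append]
    have h1 : (l₁.map (fun b => (a, b))).countP (fun p => f p.1 p.2) = (l₂.map (fun b => (a, b))).countP (fun p => f p.1 p.2) :=
      (h.map _).countP_eq _
    rw [h1, ih (fun x hx y hy => hsymm x (List.mem_cons_of_mem a hx) y (List.mem_cons_of_mem a hy))]
  | swap a b l =>
    -- pairs (b :: a :: l) = (b,a) :: map (b,·) l ++ ((a,·)-pairs ++ pairs l); pairs (a :: b :: l) symmetric
    simp only [pairs, List.map_cons, List.countP_append, List.countP_cons]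
    have hab : f b a = f a b := (hsymm a (by simp) b (by simp)).symm
    rw [hab]
    omega
  | trans h₁ h₂ ih₁ ih₂ =>
    rw [ih₁ hsymm, ih₂ (fun x hx y hy => hsymm x (h₁.symm.subset hx) y (h₁.symm.subset hy))]

/-- `pairClass` is symmetric on a list of well-formed members (from `pairClass_symm`). [folklore] -/
theorem pairClass_symm_of_wf (hwf : ∀ m ∈ l₁, m.wf = true) {a b : Member} (ha : a ∈ l₁) (hb : b ∈ l₁) :
    pairClass a b = pairClass b a :=
  pairClass_symm (Member.wf_iff.mp (hwf a ha)).1 (Member.wf_iff.mp (hwf b hb)).1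
    (add_nonneg (Member.wf_iff.mp (hwf a ha)).2 (Member.wf_iff.mp (hwf b hb)).2)

/-- THE PAIR COUNTS ARE ORDER-FREE: concordant / discordant / overlapping counts agree on any two enumerations of the
same decided members (well-formed bands, τ ≥ 0). [folklore] -/
theorem nClass_perm (c : PairClass) (h : l₁.Perm l₂) (hwf : ∀ m ∈ l₁, m.wf = true) : nClass c l₁ = nClass c l₂ := by
  unfold nClass
  exact pairs_perm_count (fun a b => decide (pairClass a b = c)) h
    (fun a ha b hb => by rw [pairClass_symm_of_wf hwf ha hb])

/-- … hence the §4.6 number of record is order-free … [folklore] -/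
theorem orderingScore_perm (h : l₁.Perm l₂) (hwf : ∀ m ∈ l₁, m.wf = true) : orderingScore l₁ = orderingScore l₂ := by
  unfold orderingScore
  rw [nClass_perm .concordant h hwf, nClass_perm .discordant h hwf]

/-- … and so is the v1.3 truth-maximum count (for a fixed top member) … [folklore] -/
theorem maxMemberDiscordant_perm (top : Member) (h : l₁.Perm l₂) (hwf : ∀ m ∈ l₁, m.wf = true) :
    maxMemberDiscordant top l₁ = maxMemberDiscordant top l₂ := by
  unfold maxMemberDiscordant
  refine pairs_perm_count (fun a b => decide (pairClass a b = .discordant) && (isTruthMax top a || isTruthMax top b)) h ?_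
  intro a ha b hb
  show (decide (pairClass a b = .discordant) && (isTruthMax top a || isTruthMax top b)) =
    (decide (pairClass b a = .discordant) && (isTruthMax top b || isTruthMax top a))
  rw [pairClass_symm_of_wf hwf ha hb, Bool.or_comm]

/-- … and the §7 ordering clause reading (same length, same counts). [folklore] -/
theorem orderingClause_perm (top : Member) (h : l₁.Perm l₂) (hwf : ∀ m ∈ l₁, m.wf = true) :
    orderingClause top l₁ = orderingClause top l₂ := by
  unfold orderingClause
  rw [nClass_perm .concordant h hwf, nClass_perm .discordant h hwf, maxMemberDiscordant_perm top h hwf, h.length_eq]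

end perm

/-! ## The LSCO reversed set of `PhaseMapOrdering` §3, enumerated backwards -/

section cases

/-- the same four members as `PhaseMapOrdering` §3 (M14 inside, M15/M16 reversed, M17 inside). [folklore] -/
private def n14 : Member := ⟨25 / 2, 9 / 2, 8, 14⟩
/-- see `n14`. [folklore] -/
private def n15r : Member := ⟨29, 3, 40, 46⟩
/-- see `n14`. [folklore] -/
private def n16r : Member := ⟨38, 2, 30, 36⟩
/-- see `n14`. [folklore] -/
private def n17 : Member := ⟨26, 4, 20, 27⟩

/-- all four are well-formed, so the permutation theorems apply. [folklore] -/
example : n14.wf = true ∧ n15r.wf = true ∧ n16r.wf = true ∧ n17.wf = true := by norm_num [Member.wf, n14, n15r, n16r, n17]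

/-- the reverse enumeration is a permutation of the original. [folklore] -/
example : [n17, n16r, n15r, n14].Perm [n14, n15r, n16r, n17] := by
  have : [n17, n16r, n15r, n14] = [n14, n15r, n16r, n17].reverse := rfl
  rw [this]
  exact List.reverse_perm _

/-- the six pair classes in the backward enumeration (the swapped pairs, classified directly). [folklore] -/
private theorem backPairs : pairClass n17 n16r = .concordant ∧ pairClass n17 n15r = .overlapping ∧ pairClass n17 n14 = .concordant ∧
    pairClass n16r n15r = .discordant ∧ pairClass n16r n14 = .concordant ∧ pairClass n15r n14 = .concordant := by
  refine ⟨?_, ?_, ?_, ?_, ?_, ?_⟩ <;> norm_num [pairClass, separable, disjoint, lt_abs, n14, n15r, n16r, n17]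

/-- backwards: still 4 concordant / 1 discordant / 1 overlapping and score 4/5 — as `nClass_perm` /
`orderingScore_perm` promise. [folklore] -/
example : nClass .concordant [n17, n16r, n15r, n14] = 4 ∧ nClass .discordant [n17, n16r, n15r, n14] = 1 ∧
    nClass .overlapping [n17, n16r, n15r, n14] = 1 := by
  simp [nClass, pairs, backPairs]

example : orderingScore [n17, n16r, n15r, n14] = some (4 / 5) := by
  simp [orderingScore, nClass, pairs, backPairs]
  norm_num

end cases

end CellScore

end Summit.Ventures.CertifiedManyBodySolver.Downfold
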